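import Summits.CriticalPhenomena.PercolationContinuityZ3.Theorems.Transplant.FKConnectivityAllQAntipodalX2SpineReach
import Summits.CriticalPhenomena.PercolationContinuityZ3.Theorems.Transplant.FKConnectivityAllQAntipodalX2SpineExtract
import HarnessLib

/-!
# Connectivity correlation inequalities for `φ_{w,q}` — the spine of a marked edge, file 4: ONE GLUING STEP — terminal connection,
# cluster count and the state of the marked pair after gluing one part

Helper file (`--supports stmt-CriticalPhenomena-4575`), FK sub-lane `prim-bschramm-fk-2` (gen 14); builds on p205010 (kernel
theorem, internal audit signed; external expert review pending).  No definitions, no named facts, no sorries; standard axioms.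

For a gluing `p.Glue M a b a' b'` (file `…X2SpineDefs`) and a configuration `ω`, with `c₀ = 1{a ↔ b in ω ∩ M}` and the visible letter
`hd = [p.kind]` if `rowVis p.kind (p.bit ω)` else `[]`:
* `FK.SpinePart.Glue.reach_step` — `1{a' ↔ b' in ω ∩ (M ∪ R)} = lastFlag c₀ hd` (flags are Booleans `c` with `c = true ↔ …`) (parallel: `c₀ ∨ bit`; series: `c₀ ∧ bit`;
  `FK.reachable_parallel_iff` / `FK.reachable_series_iff`);
* `FK.SpinePart.Glue.clusterCount_step` — `k(ω ∩ (M ∪ R)) + |V| = k(ω ∩ M) + k(ω ∩ R) + adjP c₀ hd` (`FK.clusterCount_parallel` /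
  `FK.clusterCount_series`: one cluster is saved exactly when a parallel part joining the terminals meets a composite already joining them);
* `FK.SpinePart.Glue.pairState_step` — if the pair state `st` holds for `(ω ∩ M; a, b; u, v)` (`u, v` vertices of `M`) then
  `runK st hd` holds for `(ω ∩ (M ∪ R); a', b'; u, v)` (the two-terminal substitution lemma `FK.reach_union_subst`).
[cite: Grimmett2006, §1.4 eq. (1.20) (p. 15); §3.9 (p. 63)]
-/

namespace Summit.CriticalPhenomena.PercolationContinuityZ3.Theorems

namespace FK

open SimpleGraph Literature.Probability.LatticeModels Literature.Probability.Percolation X2Word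
open scoped Classical

variable {V : Type*}

/-! ### Small tools -/

/-- The edges of a finite edge set live on its spanned vertex set. [folklore] -/
theorem span_mem (E : Finset (Sym2 V)) : ∀ e ∈ (↑E : Set (Sym2 V)), ∀ z ∈ e, z ∈ {z : V | ∃ e ∈ E, z ∈ e} :=
  fun e he _ hz => ⟨e, he, hz⟩

/-- The edges of `E ∪ {xy}` live on the spanned vertex set of `E` enlarged by `x, y`. [folklore] -/
theorem span_mem_union_pair (E : Finset (Sym2 V)) (x y : V) :
    ∀ e ∈ ((↑E : Set (Sym2 V)) ∪ {s(x, y)}), ∀ z ∈ e, z ∈ ({z : V | ∃ e ∈ E, z ∈ e} ∪ {x, y} : Set V) := by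
  rintro e (he | he) z hz
  · exact Or.inl ⟨e, he, hz⟩
  · rw [Set.mem_singleton_iff] at he; subst he
    right
    rcases Sym2.mem_iff.1 hz with rfl | rfl
    · exact Or.inl rfl
    · exact Or.inr rfl

/-- A configuration inside a union of two edge sets splits. [folklore] -/
theorem coe_inter_union (ω M R : Finset (Sym2 V)) :
    (↑(ω ∩ (M ∪ R)) : Set (Sym2 V)) = ↑(ω ∩ M) ∪ ↑(ω ∩ R) := by
  rw [Finset.inter_union_distrib_left, Finset.coe_union]

/-- The part of a configuration inside `M` consists of edges of `M`. [folklore] -/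
theorem coe_inter_subset (ω M : Finset (Sym2 V)) : (↑(ω ∩ M) : Set (Sym2 V)) ⊆ ↑M :=
  Finset.coe_subset.2 Finset.inter_subset_right

/-- The bit of a part reads the connection of its terminals. [folklore] -/
theorem SpinePart.bit_eq_true {p : SpinePart V} {ω : Finset (Sym2 V)} :
    p.bit ω = true ↔ (openGraph (↑(ω ∩ p.R) : BondConfig V)).Reachable p.x p.y := by
  unfold SpinePart.bit; exact decide_eq_true_iff

/-- The bit is `true` when the terminals are joined. [folklore] -/
theorem SpinePart.bit_of_reach {p : SpinePart V} {ω : Finset (Sym2 V)}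
    (h : (openGraph (↑(ω ∩ p.R) : BondConfig V)).Reachable p.x p.y) : p.bit ω = true :=
  SpinePart.bit_eq_true.2 h

/-- The bit is `false` when the terminals are not joined. [folklore] -/
theorem SpinePart.bit_of_not_reach {p : SpinePart V} {ω : Finset (Sym2 V)}
    (h : ¬ (openGraph (↑(ω ∩ p.R) : BondConfig V)).Reachable p.x p.y) : p.bit ω = false := by
  unfold SpinePart.bit; exact decide_eq_false h

/-- Visible letters: a joining parallel part is a particle. [folklore] -/
@[simp] theorem visHead_P_true : (if rowVis Kind.P true then [Kind.P] else ([] : List Kind)) = [Kind.P] := rfl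
/-- Visible letters: a non-joining parallel part is invisible. [folklore] -/
@[simp] theorem visHead_P_false : (if rowVis Kind.P false then [Kind.P] else ([] : List Kind)) = [] := rfl
/-- Visible letters: a joining series part is invisible. [folklore] -/
@[simp] theorem visHead_W_true : (if rowVis Kind.W true then [Kind.W] else ([] : List Kind)) = [] := rfl
/-- Visible letters: a non-joining series part is a wall. [folklore] -/
@[simp] theorem visHead_W_false : (if rowVis Kind.W false then [Kind.W] else ([] : List Kind)) = [Kind.W] := rfl
/-- The flag after a particle. [folklore] -/
@[simp] theorem lastFlag_P (b : Bool) : lastFlag b [Kind.P] = true := by cases b <;> rfl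
/-- The flag after a wall. [folklore] -/
@[simp] theorem lastFlag_W (b : Bool) : lastFlag b [Kind.W] = false := by cases b <;> rfl
/-- The flag after the empty word. [folklore] -/
@[simp] theorem lastFlag_nil (b : Bool) : lastFlag b [] = b := by cases b <;> rfl
/-- One particle read after a particle is one adjacent pair. [folklore] -/
@[simp] theorem adjP_P (b : Bool) : adjP b [Kind.P] = if b then 1 else 0 := by cases b <;> rfl
/-- A wall alone has no adjacent pair. [folklore] -/
@[simp] theorem adjP_W (b : Bool) : adjP b [Kind.W] = 0 := by cases b <;> rfl
/-- The empty word has no adjacent pair. [folklore] -/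
@[simp] theorem adjP_nil (b : Bool) : adjP b [] = 0 := by cases b <;> rfl
/-- The automaton on the empty word. [folklore] -/
@[simp] theorem runK_nil (st : PairState) : runK st [] = st := by cases st <;> rfl
/-- A particle joins a straddling pair. [folklore] -/
@[simp] theorem runK_S_P : runK .S [Kind.P] = .J := rfl
/-- A wall kills a straddling pair. [folklore] -/
@[simp] theorem runK_S_W : runK .S [Kind.W] = .D := rfl

/-- A vertex off an edge set differs from every vertex on it. [folklore] -/
theorem ne_of_not_mem_span {E : Finset (Sym2 V)} {x z : V} (hx : ∀ e ∈ E, x ∉ e) (hz : ∃ e ∈ E, z ∈ e) : x ≠ z := by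
  rintro rfl; obtain ⟨e, he, hxe⟩ := hz; exact hx e he hxe

/-- Gluing keeps the terminals distinct. [folklore] -/
theorem SpinePart.Glue.ne {p : SpinePart V} {M : Finset (Sym2 V)} {a b a' b' : V} (hg : p.Glue M a b a' b') (hab : a ≠ b) :
    a' ≠ b' := by
  cases hg with
  | par => exact hab
  | serA hR _ _ hb _ => exact (ne_of_not_mem_span hb hR.right_mem).symm
  | serB hR _ _ ha _ => exact ne_of_not_mem_span ha hR.right_mem

/-- Gluing enlarges the spanned vertex set. [folklore] -/
theorem span_mono_union {M R : Finset (Sym2 V)} {z : V} (hz : ∃ e ∈ M, z ∈ e) : ∃ e ∈ M ∪ R, z ∈ e := by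
  obtain ⟨e, he, hze⟩ := hz; exact ⟨e, Finset.mem_union_left _ he, hze⟩

/-- The interface of a parallel gluing as a set inclusion. [folklore] -/
theorem inter_span_subset_pair {M R : Finset (Sym2 V)} {a b : V}
    (hV : ∀ z : V, (∃ e ∈ M, z ∈ e) → (∃ e ∈ R, z ∈ e) → z = a ∨ z = b) :
    {z : V | ∃ e ∈ M, z ∈ e} ∩ {z : V | ∃ e ∈ R, z ∈ e} ⊆ ({a, b} : Set V) := by
  intro z hz
  rcases hV z hz.1 hz.2 with h | h
  · exact Or.inl h
  · exact Or.inr h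

/-! ### One step: terminal connection -/

/-- **Terminal connection after one gluing**: if the flag `c₀` records `1{a ↔ b in ω ∩ M}`, then `lastFlag c₀ hd` records
`1{a' ↔ b' in ω ∩ (M ∪ R)}`, `hd` the visible letter of the part (a joining parallel part is a particle, forcing `true`; a non-joining
series part is a wall, forcing `false`; invisible letters keep the flag). [folklore] -/
theorem SpinePart.Glue.reach_step {p : SpinePart V} {M : Finset (Sym2 V)} {a b a' b' : V} (hg : p.Glue M a b a' b')
    (hab : a ≠ b) (ω : Finset (Sym2 V)) {c₀ : Bool} (hc : c₀ = true ↔ (openGraph (↑(ω ∩ M) : BondConfig V)).Reachable a b) :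
    lastFlag c₀ (if rowVis p.kind (p.bit ω) then [p.kind] else []) = true ↔
      (openGraph (↑(ω ∩ (M ∪ p.R)) : BondConfig V)).Reachable a' b' := by
  cases hg with
  | @par M R a b hR hd hV =>
    have key : (openGraph (↑(ω ∩ (M ∪ R)) : BondConfig V)).Reachable a b ↔
        (openGraph (↑(ω ∩ M) : BondConfig V)).Reachable a b ∨ (openGraph (↑(ω ∩ R) : BondConfig V)).Reachable a b := by
      rw [coe_inter_union]
      exact reachable_parallel_iff (span_mem M) (span_mem R) (inter_span_subset_pair hV) (coe_inter_subset ω M)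
        (coe_inter_subset ω R)
    by_cases hr : (openGraph (↑(ω ∩ R) : BondConfig V)).Reachable a b
    · have hbit : SpinePart.bit ⟨.P, R, a, b⟩ ω = true := SpinePart.bit_of_reach hr
      rw [hbit, visHead_P_true, lastFlag_P]
      exact ⟨fun _ => key.2 (Or.inr hr), fun _ => rfl⟩
    · have hbit : SpinePart.bit ⟨.P, R, a, b⟩ ω = false := SpinePart.bit_of_not_reach hr
      rw [hbit, visHead_P_false, lastFlag_nil]
      exact hc.trans (key.trans (or_iff_left hr)).symm
  | @serA M R a b a' hR hd hV hb ha' =>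
    have hS : {z : V | ∃ e ∈ R, z ∈ e} ∩ {z : V | ∃ e ∈ M, z ∈ e} ⊆ ({a} : Set V) := fun z hz => hV z hz.2 hz.1
    have ha'b : a' ≠ b := (ne_of_not_mem_span hb hR.right_mem).symm
    have key : (openGraph (↑(ω ∩ (M ∪ R)) : BondConfig V)).Reachable a' b ↔
        (openGraph (↑(ω ∩ R) : BondConfig V)).Reachable a' a ∧ (openGraph (↑(ω ∩ M) : BondConfig V)).Reachable a b := by
      rw [coe_inter_union, Set.union_comm]
      exact reachable_series_iff (span_mem R) (span_mem M) hS (coe_inter_subset ω R) (coe_inter_subset ω M)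
        (fun h => by obtain ⟨e, he, h⟩ := h; exact ha' e he h) (fun h => by obtain ⟨e, he, h⟩ := h; exact hb e he h)
        hR.ne.symm hab.symm ha'b
    by_cases hr : (openGraph (↑(ω ∩ R) : BondConfig V)).Reachable a a'
    · have hbit : SpinePart.bit ⟨.W, R, a, a'⟩ ω = true := SpinePart.bit_of_reach hr
      rw [hbit, visHead_W_true, lastFlag_nil]
      exact hc.trans (key.trans ⟨fun h => h.2, fun h => ⟨hr.symm, h⟩⟩).symm
    · have hbit : SpinePart.bit ⟨.W, R, a, a'⟩ ω = false := SpinePart.bit_of_not_reach hr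
      rw [hbit, visHead_W_false, lastFlag_W]
      exact ⟨fun h => absurd h Bool.false_ne_true, fun h => absurd (key.1 h).1.symm hr⟩
  | @serB M R a b b' hR hd hV ha hb' =>
    have hS : {z : V | ∃ e ∈ M, z ∈ e} ∩ {z : V | ∃ e ∈ R, z ∈ e} ⊆ ({b} : Set V) := fun z hz => hV z hz.1 hz.2
    have hab' : a ≠ b' := ne_of_not_mem_span ha hR.right_mem
    have key : (openGraph (↑(ω ∩ (M ∪ R)) : BondConfig V)).Reachable a b' ↔
        (openGraph (↑(ω ∩ M) : BondConfig V)).Reachable a b ∧ (openGraph (↑(ω ∩ R) : BondConfig V)).Reachable b b' := by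
      rw [coe_inter_union]
      exact reachable_series_iff (span_mem M) (span_mem R) hS (coe_inter_subset ω M) (coe_inter_subset ω R)
        (fun h => by obtain ⟨e, he, h⟩ := h; exact ha e he h) (fun h => by obtain ⟨e, he, h⟩ := h; exact hb' e he h)
        hab hR.ne.symm hab'
    by_cases hr : (openGraph (↑(ω ∩ R) : BondConfig V)).Reachable b b'
    · have hbit : SpinePart.bit ⟨.W, R, b, b'⟩ ω = true := SpinePart.bit_of_reach hr
      rw [hbit, visHead_W_true, lastFlag_nil]
      exact hc.trans (key.trans ⟨fun h => h.1, fun h => ⟨h, hr⟩⟩).symm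
    · have hbit : SpinePart.bit ⟨.W, R, b, b'⟩ ω = false := SpinePart.bit_of_not_reach hr
      rw [hbit, visHead_W_false, lastFlag_W]
      exact ⟨fun h => absurd h Bool.false_ne_true, fun h => absurd (key.1 h).2 hr⟩

/-! ### One step: cluster count -/

section Count

variable [Fintype V]

/-- **Cluster count after one gluing**: `k(ω ∩ (M ∪ R)) + |V| = k(ω ∩ M) + k(ω ∩ R) + adjP (1{a ↔ b in ω ∩ M}) hd` — a parallel part
joining the terminals of a composite that already joins them closes a cycle (one cluster fewer is merged), which is exactly one
ADJACENT particle pair in the row word. [cite: Grimmett2006, §1.4 eq. (1.20) (p. 15)] -/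
theorem SpinePart.Glue.clusterCount_step {p : SpinePart V} {M : Finset (Sym2 V)} {a b a' b' : V} (hg : p.Glue M a b a' b')
    (hab : a ≠ b) (ω : Finset (Sym2 V)) {c₀ : Bool} (hc : c₀ = true ↔ (openGraph (↑(ω ∩ M) : BondConfig V)).Reachable a b) :
    clusterCount (↑(ω ∩ (M ∪ p.R)) : BondConfig V) ∅ + Fintype.card V =
      clusterCount (↑(ω ∩ M) : BondConfig V) ∅ + clusterCount (↑(ω ∩ p.R) : BondConfig V) ∅ +
        adjP c₀ (if rowVis p.kind (p.bit ω) then [p.kind] else []) := by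
  cases hg with
  | @par M R a b hR hd hV =>
    have key := clusterCount_parallel (span_mem M) (span_mem R) (inter_span_subset_pair hV) (coe_inter_subset ω M)
      (coe_inter_subset ω R) hab
    rw [← coe_inter_union] at key
    rw [key]
    by_cases hr : (openGraph (↑(ω ∩ R) : BondConfig V)).Reachable a b
    · have hbit : SpinePart.bit ⟨.P, R, a, b⟩ ω = true := SpinePart.bit_of_reach hr
      rw [hbit, visHead_P_true, adjP_P]
      by_cases hm : (openGraph (↑(ω ∩ M) : BondConfig V)).Reachable a b
      · rw [if_pos ⟨hm, hr⟩, if_pos (hc.2 hm)]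
      · have hc0 : c₀ = false := by
          cases c₀
          · rfl
          · exact absurd (hc.1 rfl) hm
        rw [if_neg (fun h => hm h.1), hc0]; rfl
    · have hbit : SpinePart.bit ⟨.P, R, a, b⟩ ω = false := SpinePart.bit_of_not_reach hr
      rw [hbit, visHead_P_false, adjP_nil, if_neg (fun h => hr h.2)]
  | @serA M R a b a' hR hd hV hb ha' =>
    have hS : {z : V | ∃ e ∈ M, z ∈ e} ∩ {z : V | ∃ e ∈ R, z ∈ e} ⊆ ({a} : Set V) := fun z hz => hV z hz.1 hz.2
    have key := clusterCount_series (span_mem M) (span_mem R) hS (coe_inter_subset ω M) (coe_inter_subset ω R)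
    rw [← coe_inter_union] at key
    rw [key]
    have h0 : adjP c₀ (if rowVis Kind.W (SpinePart.bit ⟨.W, R, a, a'⟩ ω) then [Kind.W] else []) = 0 := by
      cases SpinePart.bit ⟨.W, R, a, a'⟩ ω
      · rw [visHead_W_false, adjP_W]
      · rw [visHead_W_true, adjP_nil]
    rw [h0, add_zero]
  | @serB M R a b b' hR hd hV ha hb' =>
    have hS : {z : V | ∃ e ∈ M, z ∈ e} ∩ {z : V | ∃ e ∈ R, z ∈ e} ⊆ ({b} : Set V) := fun z hz => hV z hz.1 hz.2
    have key := clusterCount_series (span_mem M) (span_mem R) hS (coe_inter_subset ω M) (coe_inter_subset ω R)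
    rw [← coe_inter_union] at key
    rw [key]
    have h0 : adjP c₀ (if rowVis Kind.W (SpinePart.bit ⟨.W, R, b, b'⟩ ω) then [Kind.W] else []) = 0 := by
      cases SpinePart.bit ⟨.W, R, b, b'⟩ ω
      · rw [visHead_W_false, adjP_W]
      · rw [visHead_W_true, adjP_nil]
    rw [h0, add_zero]

end Count

end FK

end Summit.CriticalPhenomena.PercolationContinuityZ3.Theorems
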